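import Summits.CriticalPhenomena.PercolationContinuityZ3.Theses.PercNearOneGluing
import Summits.CriticalPhenomena.PercolationContinuityZ3.Theorems.PercNearOneGluingAdditiveGluingLastExitCut
import Summits.CriticalPhenomena.PercolationContinuityZ3.Theorems.PercNearOneGluingAdditiveGluingPocketMarkov
import HarnessLib

/-!
# Crux `PercNearOneGluing.AdditiveGluing` (stmt-CriticalPhenomena-4576), line `replica-splice-at-entrance` —
# the pocket identities and the reduction of the crux to the pocket bound (lead c2)

With the two landed tool stubs of the line (`stub_lastExitCut`, p122975; `stub_pocketMarkov`, p123158) the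
entrance-stopping-set decomposition of Kozma–Nitzan / Gladkov–Zimin becomes two EXACT identities, proved here
sorry-free over the raw tree vocabulary (relay set `A ∋ b`, source `o`; `W(ω)` = the `A`-avoiding pocket of `o`,
`N(ω) ⊆ A` = the first contacts, `w_W` = `w` with the pairs meeting `W` zeroed):

* `pocketReduction_openConn_eq_sum`:  `P(o ↔ b) = Σ_{W,N} μ{W(ω)=W, N(ω)=N} · P_{w_W}(N ↔ b)`;
* `pocketReduction_liveFailure_eq_sum`:  `P(o ↔ A, o ↮ b) = Σ_{W,N} μ{W(ω)=W, N(ω)=N} · 1_{N≠∅} · (1 − P_{w_W}(N ↔ b))`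
  ("the live failure is the average off-pocket failure of the entrance set");
* `stub_additiveGluingOfPocketGluing` (registered sub-goal, proved by name): the crux `AdditiveGluing` follows from
  the POCKET BOUND `Σ_{W,N} μ{…}·1_{N≠∅}(1 − P_{w_W}(N ↔ b)) ≤ t` for `b ∈ A`, `0 ≤ t`, `P(a ↔ b) ≥ 1 − t` on `A`
  (apply it to `A ∪ {b}`).  By the second identity the pocket bound is EQUIVALENT to the crux for relay sets
  containing `b`; it is the registered load-bearing stub `stub_pocketGluing` of the line's skeleton.

Sources: KozmaNitzan2024 (arXiv:2401.12397) §3.2 (Thm 4–5, Lemma 5), §5.6(4); Gladkov2024 (arXiv:2408.08457)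
Lemma 3.1; Grimmett1999 §1.3.  No new definitions; lands with `--supports stmt-CriticalPhenomena-4576`.
-/

noncomputable section

namespace Summit.CriticalPhenomena.PercolationContinuityZ3.Theorems

open MeasureTheory Literature.Probability.LatticeModels Literature.Probability.Percolation
open scoped Classical BigOperators

variable {n : ℕ}

/-- Partition of an event by the pocket data `(W(ω), N(ω))`:
`μ(E) = Σ_{W,N} μ({W(ω) = W, N(ω) = N} ∩ E)`. [folklore] -/
theorem pocketReduction_sum_pocketEvent (w : Sym2 (Fin n) → unitInterval) (A : Finset (Fin n))
    (o : Fin n) (E : Set (BondConfig (Fin n))) :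
    (prodBernoulli w).real E =
      ∑ W : Finset (Fin n), ∑ N : Finset (Fin n), (prodBernoulli w).real
        ({ω : BondConfig (Fin n) |
            (Finset.univ.filter fun v => ω ∈ openConnIn ((↑A : Set (Fin n))ᶜ) o v) = W ∧
            (A.filter fun a => ω ∈ openConnIn (insert a ((↑A : Set (Fin n))ᶜ)) o a) = N} ∩ E) := by
  set f : BondConfig (Fin n) → Finset (Fin n) × Finset (Fin n) := fun ω =>
    ((Finset.univ.filter fun v => ω ∈ openConnIn ((↑A : Set (Fin n))ᶜ) o v),
      (A.filter fun a => ω ∈ openConnIn (insert a ((↑A : Set (Fin n))ᶜ)) o a)) with hf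
  have h1 : ∀ v : Finset (Fin n) × Finset (Fin n), MeasurableSet (f ⁻¹' {v}) :=
    fun v => (Set.toFinite _).measurableSet
  have h := sum_measureReal_preimage_singleton (μ := (prodBernoulli w).restrict E)
    (Finset.univ : Finset (Finset (Fin n) × Finset (Fin n))) (f := f) (fun v _ => h1 v)
  rw [Finset.coe_univ, Set.preimage_univ, measureReal_restrict_apply MeasurableSet.univ,
    Set.univ_inter] at h
  rw [← h, Fintype.sum_prod_type]
  refine Finset.sum_congr rfl fun W _ => Finset.sum_congr rfl fun N _ => ?_
  rw [measureReal_restrict_apply (h1 _)]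
  congr 1
  ext ω
  simp only [Set.mem_inter_iff, Set.mem_preimage, Set.mem_singleton_iff, hf, Prod.ext_iff,
    Set.mem_setOf_eq]

/-- FIRST ENTRANCE: `o ↔ A` iff the entrance set `N(ω)` is nonempty (an open walk from `o` to a point of
`A` meets `A` a first time; conversely a first contact is joined to `o`). [folklore] -/
theorem pocketReduction_contacts_nonempty_iff (A : Finset (Fin n)) (o : Fin n) (ω : BondConfig (Fin n)) :
    (A.filter fun a => ω ∈ openConnIn (insert a ((↑A : Set (Fin n))ᶜ)) o a).Nonempty ↔
      ω ∈ ⋃ a ∈ A, (openConn o a : Set (BondConfig (Fin n))) := by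
  constructor
  · rintro ⟨a, ha⟩
    rw [Finset.mem_filter] at ha
    simp only [Set.mem_iUnion, exists_prop]
    exact ⟨a, ha.1, DCT16.reachable_of_pathIn (DCT16.pathIn_of_mem_openConnIn ha.2)⟩
  · intro h
    simp only [Set.mem_iUnion, exists_prop] at h
    obtain ⟨a, ha, hreach⟩ := h
    have key : ∀ (u x : Fin n) (p : (openGraph ω).Walk u x), x ∈ A →
        ∃ a' ∈ A, ω ∈ openConnIn (insert a' ((↑A : Set (Fin n))ᶜ)) u a' := by
      intro u x p
      induction p with
      | nil =>
        intro hx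
        exact ⟨_, hx, Set.mem_insert _ _, Set.mem_insert _ _, SimpleGraph.Reachable.refl _⟩
      | @cons u v x hadj p ih =>
        intro hx
        by_cases hu : u ∈ A
        · exact ⟨u, hu, Set.mem_insert _ _, Set.mem_insert _ _, SimpleGraph.Reachable.refl _⟩
        · obtain ⟨a', ha', hv, hy, hr⟩ := ih hx
          have hu' : u ∈ insert a' ((↑A : Set (Fin n))ᶜ) :=
            Set.mem_insert_of_mem _ (by simpa using hu)
          refine ⟨a', ha', hu', hy, SimpleGraph.Reachable.trans ?_ hr⟩
          refine SimpleGraph.Adj.reachable ?_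
          simp only [SimpleGraph.induce, SimpleGraph.comap_adj, Function.Embedding.coe_subtype]
          exact hadj
    obtain ⟨p⟩ := hreach
    obtain ⟨a', ha', hmem⟩ := key o a p ha
    exact ⟨a', Finset.mem_filter.2 ⟨ha', hmem⟩⟩

/-- `{N(ω) ≠ ∅} = {o ↔ A}` as events. [folklore] -/
theorem pocketReduction_setOf_contacts_nonempty (A : Finset (Fin n)) (o : Fin n) :
    {ω : BondConfig (Fin n) |
        (A.filter fun a => ω ∈ openConnIn (insert a ((↑A : Set (Fin n))ᶜ)) o a).Nonempty} =
      ⋃ a ∈ A, (openConn o a : Set (BondConfig (Fin n))) :=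
  Set.ext fun ω => pocketReduction_contacts_nonempty_iff A o ω

/-- `c · μ(o ↔ A)` as a sum over pocket data of `c · 1_{N ≠ ∅}`. [folklore] -/
theorem pocketReduction_sum_nonempty (w : Sym2 (Fin n) → unitInterval) (A : Finset (Fin n))
    (o : Fin n) (c : ℝ) :
    ∑ W : Finset (Fin n), ∑ N : Finset (Fin n), (prodBernoulli w).real
        {ω : BondConfig (Fin n) |
            (Finset.univ.filter fun v => ω ∈ openConnIn ((↑A : Set (Fin n))ᶜ) o v) = W ∧
            (A.filter fun a => ω ∈ openConnIn (insert a ((↑A : Set (Fin n))ᶜ)) o a) = N} *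
          (if N.Nonempty then c else 0) =
      c * (prodBernoulli w).real (⋃ a ∈ A, (openConn o a : Set (BondConfig (Fin n)))) := by
  rw [← pocketReduction_setOf_contacts_nonempty A o,
    pocketReduction_sum_pocketEvent w A o {ω : BondConfig (Fin n) |
      (A.filter fun a => ω ∈ openConnIn (insert a ((↑A : Set (Fin n))ᶜ)) o a).Nonempty}, Finset.mul_sum]
  refine Finset.sum_congr rfl fun W _ => ?_
  rw [Finset.mul_sum]
  refine Finset.sum_congr rfl fun N _ => ?_
  by_cases hN : N.Nonempty
  · rw [if_pos hN, mul_comm]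
    congr 2
    ext ω
    simp only [Set.mem_inter_iff, Set.mem_setOf_eq]
    constructor
    · intro h
      refine ⟨h, ?_⟩
      rw [h.2]
      exact hN
    · rintro ⟨h, -⟩
      exact h
  · rw [if_neg hN, mul_zero]
    have : ({ω : BondConfig (Fin n) |
          (Finset.univ.filter fun v => ω ∈ openConnIn ((↑A : Set (Fin n))ᶜ) o v) = W ∧
          (A.filter fun a => ω ∈ openConnIn (insert a ((↑A : Set (Fin n))ᶜ)) o a) = N} ∩
        {ω : BondConfig (Fin n) |
          (A.filter fun a => ω ∈ openConnIn (insert a ((↑A : Set (Fin n))ᶜ)) o a).Nonempty}) = ∅ := by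
      ext ω
      simp only [Set.mem_inter_iff, Set.mem_setOf_eq, Set.mem_empty_iff_false, iff_false, not_and]
      rintro ⟨-, rfl⟩
      exact hN
    rw [this, measureReal_empty, mul_zero]

/-- `μ(U ∩ Vᶜ) = μ(U) − μ(V)` for `V ⊆ U` (finite configuration space). [folklore] -/
theorem pocketReduction_measureReal_inter_compl (w : Sym2 (Fin n) → unitInterval)
    {U V : Set (BondConfig (Fin n))} (hVU : V ⊆ U) :
    (prodBernoulli w).real (U ∩ Vᶜ) = (prodBernoulli w).real U - (prodBernoulli w).real V := by
  have hdisj : Disjoint (U ∩ Vᶜ) V := Set.disjoint_left.2 fun ω hω hωV => hω.2 hωV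
  have hunion : (U ∩ Vᶜ) ∪ V = U := by
    ext ω
    simp only [Set.mem_union, Set.mem_inter_iff, Set.mem_compl_iff]
    constructor
    · rintro (⟨hU, -⟩ | hV)
      · exact hU
      · exact hVU hV
    · intro hU
      by_cases hV : ω ∈ V
      · exact Or.inr hV
      · exact Or.inl ⟨hU, hV⟩
  have h := measureReal_union (μ := prodBernoulli w) hdisj (Set.toFinite V).measurableSet
  rw [hunion] at h
  linarith

/-- **The identity of the line** (`b ∈ A`): `P(o ↔ b) = Σ_{W,N} μ{W(ω) = W, N(ω) = N} · P_{w_W}(N ↔ b)`,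
where `w_W` is `w` with the pairs meeting `W` zeroed — partition by pocket data, last-exit decomposition
(`stub_lastExitCut`) and the spatial Markov property at the entrance stopping set (`stub_pocketMarkov`).
[cite: KozmaNitzan2024, §3.2 (proof of Thm 5, p.14)] -/
theorem pocketReduction_openConn_eq_sum (w : Sym2 (Fin n) → unitInterval) (A : Finset (Fin n))
    (o b : Fin n) (hb : b ∈ A) :
    (prodBernoulli w).real (openConn o b) =
      ∑ W : Finset (Fin n), ∑ N : Finset (Fin n), (prodBernoulli w).real
        {ω : BondConfig (Fin n) |
            (Finset.univ.filter fun v => ω ∈ openConnIn ((↑A : Set (Fin n))ᶜ) o v) = W ∧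
            (A.filter fun a => ω ∈ openConnIn (insert a ((↑A : Set (Fin n))ᶜ)) o a) = N} *
          (prodBernoulli (fun e : Sym2 (Fin n) => if ∃ v ∈ W, v ∈ e then (0 : unitInterval) else w e)).real
            (⋃ a ∈ N, openConn a b) := by
  rw [pocketReduction_sum_pocketEvent w A o (openConn o b)]
  refine Finset.sum_congr rfl fun W _ => Finset.sum_congr rfl fun N _ => ?_
  rw [stub_lastExitCut n A o b hb W N, stub_pocketMarkov n w A o b W N]

/-- **Live failure = average off-pocket failure of the entrance set** (`b ∈ A`):
`P(o ↔ A, o ↮ b) = Σ_{W,N} μ{W(ω) = W, N(ω) = N} · 1_{N ≠ ∅} · (1 − P_{w_W}(N ↔ b))`.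
[cite: KozmaNitzan2024, §3.2 (p.12, the good-quadruple bookkeeping)] -/
theorem pocketReduction_liveFailure_eq_sum (w : Sym2 (Fin n) → unitInterval) (A : Finset (Fin n))
    (o b : Fin n) (hb : b ∈ A) :
    (prodBernoulli w).real ((⋃ a ∈ A, openConn o a) ∩ (openConn o b)ᶜ) =
      ∑ W : Finset (Fin n), ∑ N : Finset (Fin n), (prodBernoulli w).real
        {ω : BondConfig (Fin n) |
            (Finset.univ.filter fun v => ω ∈ openConnIn ((↑A : Set (Fin n))ᶜ) o v) = W ∧
            (A.filter fun a => ω ∈ openConnIn (insert a ((↑A : Set (Fin n))ᶜ)) o a) = N} *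
          (if N.Nonempty then
              1 - (prodBernoulli (fun e : Sym2 (Fin n) =>
                    if ∃ v ∈ W, v ∈ e then (0 : unitInterval) else w e)).real (⋃ a ∈ N, openConn a b)
            else 0) := by
  set μ := prodBernoulli w with hμ
  -- `{o ↔ b} ⊆ {o ↔ A}` since `b ∈ A`
  have hsub : (openConn o b : Set (BondConfig (Fin n))) ⊆ ⋃ a ∈ A, openConn o a := fun ω hω =>
    Set.mem_biUnion (Finset.mem_coe.2 hb) hω
  have hdiff : μ.real ((⋃ a ∈ A, openConn o a) ∩ (openConn o b)ᶜ) =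
      μ.real (⋃ a ∈ A, openConn o a) - μ.real (openConn o b) :=
    pocketReduction_measureReal_inter_compl w hsub
  -- the identity of the line, with the `N = ∅` terms written as zero
  have hid := pocketReduction_openConn_eq_sum w A o b hb
  have hterm : ∀ W N : Finset (Fin n),
      μ.real {ω : BondConfig (Fin n) |
            (Finset.univ.filter fun v => ω ∈ openConnIn ((↑A : Set (Fin n))ᶜ) o v) = W ∧
            (A.filter fun a => ω ∈ openConnIn (insert a ((↑A : Set (Fin n))ᶜ)) o a) = N} *
          (prodBernoulli (fun e : Sym2 (Fin n) => if ∃ v ∈ W, v ∈ e then (0 : unitInterval) else w e)).real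
            (⋃ a ∈ N, openConn a b) =
        μ.real {ω : BondConfig (Fin n) |
            (Finset.univ.filter fun v => ω ∈ openConnIn ((↑A : Set (Fin n))ᶜ) o v) = W ∧
            (A.filter fun a => ω ∈ openConnIn (insert a ((↑A : Set (Fin n))ᶜ)) o a) = N} *
          (if N.Nonempty then (1 : ℝ) else 0) -
        μ.real {ω : BondConfig (Fin n) |
            (Finset.univ.filter fun v => ω ∈ openConnIn ((↑A : Set (Fin n))ᶜ) o v) = W ∧
            (A.filter fun a => ω ∈ openConnIn (insert a ((↑A : Set (Fin n))ᶜ)) o a) = N} *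
          (if N.Nonempty then
              1 - (prodBernoulli (fun e : Sym2 (Fin n) =>
                    if ∃ v ∈ W, v ∈ e then (0 : unitInterval) else w e)).real (⋃ a ∈ N, openConn a b)
            else 0) := by
    intro W N
    by_cases hN : N.Nonempty
    · rw [if_pos hN, if_pos hN]; ring
    · rw [if_neg hN, if_neg hN, Finset.not_nonempty_iff_eq_empty.1 hN]
      simp
  have hsplit : μ.real (openConn o b) =
      1 * μ.real (⋃ a ∈ A, openConn o a) -
      ∑ W : Finset (Fin n), ∑ N : Finset (Fin n), μ.real
        {ω : BondConfig (Fin n) |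
            (Finset.univ.filter fun v => ω ∈ openConnIn ((↑A : Set (Fin n))ᶜ) o v) = W ∧
            (A.filter fun a => ω ∈ openConnIn (insert a ((↑A : Set (Fin n))ᶜ)) o a) = N} *
          (if N.Nonempty then
              1 - (prodBernoulli (fun e : Sym2 (Fin n) =>
                    if ∃ v ∈ W, v ∈ e then (0 : unitInterval) else w e)).real (⋃ a ∈ N, openConn a b)
            else 0) := by
    rw [hid, ← pocketReduction_sum_nonempty w A o 1, ← Finset.sum_sub_distrib]
    refine Finset.sum_congr rfl fun W _ => ?_
    rw [← Finset.sum_sub_distrib]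
    exact Finset.sum_congr rfl fun N _ => hterm W N
  rw [hdiff, hsplit]
  ring

/-- **Registered sub-goal `stub_additiveGluingOfPocketGluing`: the crux follows from the POCKET BOUND.**
If for every weighted graph, every relay set `A ∋ b`, every source `o` and every admissible slack `t`
(`0 ≤ t`, `P(a ↔ b) ≥ 1 − t` on `A`) the average off-pocket failure of the entrance set is at most `t`, then
`AdditiveGluing` holds: apply the bound to `A ∪ {b}` and use `P(o ↔ A) ≤ P(o ↔ A ∪ {b})`,
`P(o ↔ A ∪ {b}) − P(o ↔ b) = P(o ↔ A ∪ {b}, o ↮ b)` and `pocketReduction_liveFailure_eq_sum`.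
[cite: KozmaNitzan2024, §5.6(4) and §3.2] -/
theorem stub_additiveGluingOfPocketGluing :
    (∀ (n : ℕ) (w : Sym2 (Fin n) → unitInterval) (A : Finset (Fin n)) (o b : Fin n) (t : ℝ), b ∈ A → 0 ≤ t →
      (∀ a ∈ A, 1 - t ≤ (prodBernoulli w).real (openConn a b)) →
      ∑ W : Finset (Fin n), ∑ N : Finset (Fin n),
        (prodBernoulli w).real
            {ω : BondConfig (Fin n) |
              (Finset.univ.filter fun v => ω ∈ openConnIn ((↑A : Set (Fin n))ᶜ) o v) = W ∧
              (A.filter fun a => ω ∈ openConnIn (insert a ((↑A : Set (Fin n))ᶜ)) o a) = N} *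
          (if N.Nonempty then
              1 - (prodBernoulli (fun e : Sym2 (Fin n) => if ∃ v ∈ W, v ∈ e then (0 : unitInterval) else w e)).real
                    (⋃ a ∈ N, openConn a b)
            else 0) ≤ t) →
    Summit.CriticalPhenomena.PercolationContinuityZ3.Theses.PercNearOneGluing.AdditiveGluing := by
  intro hpocket n w A o b t ht hA
  set μ := prodBernoulli w with hμ
  set A' : Finset (Fin n) := insert b A with hA'
  have hb : b ∈ A' := Finset.mem_insert_self b A
  have hA'rel : ∀ a ∈ A', 1 - t ≤ μ.real (openConn a b) := by
    intro a ha
    rcases Finset.mem_insert.1 ha with rfl | ha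
    · have : (openConn a a : Set (BondConfig (Fin n))) = Set.univ :=
        Set.eq_univ_iff_forall.2 fun ω => SimpleGraph.Reachable.refl _
      rw [this, probReal_univ]
      linarith
    · exact hA a ha
  have hmono : μ.real (⋃ a ∈ A, openConn o a) ≤ μ.real (⋃ a ∈ A', openConn o a) := by
    refine measureReal_mono ?_ (measure_ne_top _ _)
    exact Set.biUnion_subset_biUnion_left fun a ha => Finset.subset_insert b A ha
  have hsub : (openConn o b : Set (BondConfig (Fin n))) ⊆ ⋃ a ∈ A', openConn o a := fun ω hω =>
    Set.mem_biUnion (Finset.mem_coe.2 hb) hω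
  have hdiff : μ.real ((⋃ a ∈ A', openConn o a) ∩ (openConn o b)ᶜ) =
      μ.real (⋃ a ∈ A', openConn o a) - μ.real (openConn o b) :=
    pocketReduction_measureReal_inter_compl w hsub
  have hlive := pocketReduction_liveFailure_eq_sum w A' o b hb
  have hbound := hpocket n w A' o b t hb ht hA'rel
  rw [← hlive, hdiff] at hbound
  linarith

end Summit.CriticalPhenomena.PercolationContinuityZ3.Theorems

end
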